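import Literature.MathematicalPhysics.QuantumFieldTheory.Balaban1983to89.B9Eq349ConjugatedDPChainTower
import Literature.MathematicalPhysics.QuantumFieldTheory.Balaban1983to89.B9Eq349ConjugatedGreenBlockDecayTower

/-!
# `Balaban1983to89.B9Eq349ConjugatedProjectionBlockDecayTower` — T. Bałaban, *Propagators for lattice gauge theories in a background field*, Commun.
# Math. Phys. **99** (1985) 389–434 [Balaban1985BackgroundPropagators] (3.49) p. 399 with Thm 3.11 p. 416 and (3.21)∕(3.25) p. 394: **BIG-BLOCK `L²`
# DECAY OF PRINT's `k`-LEVEL PROJECTION `P_k(U) = 1 − R_k(U)` ON `T_{L^{n+1}m}`, AT EVERY HEIGHT, MODULO THE LETTERS `γ`, `C_Q`, `κ₁`** — the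
# conjugated bound `‖e^{κM_χ} P_k(U) e^{−κM_χ}‖ ≤ 2` on the whole circle `‖κ‖ = ρ` (`B9Eq349ConjugatedDPChainTower.norm_conjProjk_chain_le_two` with the
# multipliers built inside) and its big-block read-out `‖P_{y₁} ∘ P_k(U) ∘ P_{y₀}‖ ≤ 2e^{ρ}e^{−ρ·d_m(y₀,y₁)}`
# (`B9Eq349ConjugatedGreenBlockDecayTower.norm_block_le_exp_of_uniform_circle_bound_cast` at `N = L^{n+1}`) — (3.49)'s `P` line at `k` levels in
# `L²` block-operator currency; route R2′ road B8″, row L8 at the tower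

statement-level skeleton of published theorems with citation tags; proofs where landed; nothing here is a claim about the Yang–Mills mass gap

CITATION HEADER (lean-in-tree rule).  Audit cell `pub-balaban`, sub-cell `t4`, BINDER row NE9; filed by NE9 formalisation-swarm LEAF PROVER 03
(`b2b-balaban-t4-ne9-formalise-leaf-03`, gen 74), composing BY NAME this lineage's `B9Eq349ConjugatedDPChainTower` and `B9Eq349ConjugatedGreenBlockDecayTower`
(gen 74) and (G) `B9Eq3101ExpPointwiseMultiplier`.  Source READ in the held text [Balaban1985BackgroundPropagators]: p. 399 *«For the operator P = I − R
we obtain … |P(x,x′)| … ≤ O(1)[…]e^{−δ₀d(y,y′)} (3.49)»*; p. 416 Thm 3.11; p. 394 (3.21), (3.25).  Print's road is the random walk; the conjugation is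
the ROUTE's substitute; NOTHING of print's `δ₀` is asserted.

WHAT IS PROVED (sorry-free; proof lane — no `def`; [folklore] composition BY NAME).
* §1 **`norm_conjProjk_le_of_circle`** — `‖exp(κ•M_S) ∘ (1 − R_k(U)) ∘ exp(κ•(−M_S))‖ ≤ 2`, `‖κ‖ = ρ`, windows `ρℓη ≤ 1`, `ρℓ′ ≤ 1`,
  `2ρℓM_φM_φ′√d ≤ β ≤ 1`, `2ρℓ′C_Q ≤ β`, `3(1+a′)β² ≤ γ∕4`, `12·s_A·β ≤ √κ₁`.
* §2 **`block_decay_Pk_of_letters`** — on print's diagonal `ηL^{n+1} = 1`, at EVERY height: `‖P_{y₁} ∘ (1 − R_k(U)) ∘ P_{y₀}‖ ≤ 2·e^{ρ}·e^{−ρ·d_m(y₀,y₁)}`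
  for every (K1) big-block family, ANY positivity witness; `γ ≤ 1`, `C_Q`, `κ₁` displayed.
* §3 **`exists_block_decay_Pk`** — given `κ₁ > 0`: `∃ α₁ C ρ > 0` BEFORE `∀ n η c₀ c₁ m U α ε_j hpos′`, the `κ₁`-certificate, `P`, `y₀ y₁`:
  `‖P_{y₁} ∘ (1 − R_k(U)) ∘ P_{y₀}‖ ≤ C·e^{−ρ·d_m(y₀,y₁)}` — `γ′, α₀` by MY g64, `C_Q ≤ E` by `…GreenBlockDecayTower.norm_QtildeTower_le_of_profile`.
HONEST SCOPE.  [folklore] plumbing; the letters `γ`, `C_Q` have level-free inhabitants in the tree (this lineage's g64 ∕ `…GreenBlockDecayTower.norm_QtildeTower_le_of_profile`),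
`κ₁` is KAPPA1 (inhabitants `B9Eq365QGGQLowerVariationalWindowTower(Diagonal)`); the `DP` line of (3.49) needs in addition the bump-section letters `Ψ`, `C_Ψ`
(`B9Eq349ConjugatedDPChainTower` §6) and is NOT read out here; NOT NE9 (cell pub-balaban: NE9 NOT PRINTED ∕ NOT PROVED; «NE9 ⇐ the named binders»; row WALLED
ON A MODEL (O-NE9-1; #5 UNRULED); spine PROVED 0∕9; rung (B)+1 on a finite T⁴ — NOT infinite volume, NOT mass gap, NOT BetaPertH, NOT Clay; HONEST DEPENDENCY:
continuum YM on T⁴ ⇐ BetaPertH ∧ nine spine estimates (0/9 proved); BetaPertH ⇐ (D1) ∧ (D4) ∧ CAP+tail; G-an2-4 gates asym, D1 and NE2/3/4).  NEW file;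
nothing modified.  Net new unproved facts: 0.
-/

noncomputable section

set_option autoImplicit false

open scoped InnerProductSpace ComplexConjugate BigOperators
open NormedSpace

namespace Literature.MathematicalPhysics.QuantumFieldTheory.Balaban1983to89.B9Eq349ConjugatedProjectionBlockDecayTower

open B4Sect5Torus (TSite tdist)
open B9SectCLatticeCarrier (Bond bpos btgt)
open B9Eq311L2Pairing (WL2)
open B9Eq319QprimeTorus (fineP blockCoord)
open B9Eq315QTower (towerP UlevOf)
open B9Eq316TowerFlatIsOneStep (siteCast towerP_eq_fineP_pow)
open B11Eq103H1Complex (SiteL2K BondL2K covDerivL2K)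
open B7Prop1Explicit (U1)
open B9Eq310HessianOperator (adTransportW)
open B9Eq326OperatorTower (QprimeTowerW RofUk)
open B9Eq324DeltaPrimeATower (laplacePrimeAk GpOfUk re_inner_laplacePrimeAk)
open B9Eq349ConjugatedDPChainTower (norm_conjProjk_chain_le_two)
open B9Eq349ConjugatedGreenBlockDecayTower (norm_block_le_exp_of_uniform_circle_bound_cast norm_QtildeTower_le_of_profile)

/-! ## §1 The conjugated projection of the tower on the circle `‖κ‖ = ρ` -/

section Circle

variable {d : ℕ} {L : ℕ} [NeZero L] {m : Fin d → ℕ} [∀ i, NeZero (m i)] {n : ℕ}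
  {𝔸 : Type*} [NormedRing 𝔸] [NormedAlgebra ℂ 𝔸] [CompleteSpace 𝔸] [NormOneClass 𝔸]
  {W : Type*} [NormedAddCommGroup W] [InnerProductSpace ℂ W] [FiniteDimensional ℂ W] {φ : W ≃ₗ[ℂ] 𝔸} {Mφ Mφ' : ℝ}
  (hφ : ∀ w, ‖φ w‖ ≤ Mφ * ‖w‖) (hφ' : ∀ X, ‖φ.symm X‖ ≤ Mφ' * ‖X‖) (hMφ : 0 ≤ Mφ) (hMφ' : 0 ≤ Mφ')
  {c₀ : ℝ} [Fact (0 < c₀)] {η : ℝ} (hη : 0 < η) {U : Bond d (towerP L m (n + 1)) → 𝔸ˣ} (hU : ∀ b, U b ∈ U1 𝔸)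
  {c₁ : ℝ} [Fact (0 < c₁)] {a' : ℝ} (ha' : 0 ≤ a')
  (hRS : ∀ (b : Bond d (towerP L m (n + 1))) (v u : W), ⟪adTransportW φ U b v, u⟫_ℂ = ⟪v, adTransportW φ (fun b => (U b)⁻¹) b u⟫_ℂ)
  (hpos' : ∀ x : SiteL2K ℂ d (towerP L m (n + 1)) c₀ W, x ≠ 0 → 0 < RCLike.re ⟪x, laplacePrimeAk L m n φ η U a' (c₁ := c₁) x⟫_ℂ)
  {CQ : ℝ} (hCQ : 0 ≤ CQ)
  (hQ : ∀ s, ‖((WL2.linearEquiv ℂ ℂ (fun _ : TSite d m => c₁)).symm.toLinearMap ∘ₗ QprimeTowerW L m n φ U (c₀ := c₀)) s‖ ≤ CQ * ‖s‖)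
  {γ : ℝ} (hγ : 0 < γ) (hγ1 : γ ≤ 1)
  (coercive : ∀ f : SiteL2K ℂ d (towerP L m (n + 1)) c₀ W, γ * ‖f‖ ^ 2 ≤ ‖(covDerivL2K ℂ c₀ ((η : ℂ))⁻¹ (adTransportW φ U)) f‖ ^ 2 +
    a' * ‖((WL2.linearEquiv ℂ ℂ (fun _ : TSite d m => c₁)).symm.toLinearMap ∘ₗ QprimeTowerW L m n φ U (c₀ := c₀)) f‖ ^ 2)
  {κ₁ : ℝ} (hκ₁ : 0 < κ₁)
  (hκ : ∀ ψ : SiteL2K ℂ d m c₁ W, κ₁ * ‖ψ‖ ^ 2 ≤ RCLike.re ⟪ψ,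
    (((WL2.linearEquiv ℂ ℂ (fun _ : TSite d m => c₁)).symm.toLinearMap ∘ₗ QprimeTowerW L m n φ U (c₀ := c₀)) ∘ₗ
      GpOfUk L m n φ η U a' (c₁ := c₁) hpos' ∘ₗ GpOfUk L m n φ η U a' (c₁ := c₁) hpos' ∘ₗ
      LinearMap.adjoint ((WL2.linearEquiv ℂ ℂ (fun _ : TSite d m => c₁)).symm.toLinearMap ∘ₗ QprimeTowerW L m n φ U (c₀ := c₀))) ψ⟫_ℂ)
  {ℓ ℓ' : ℝ} (hℓ : 0 ≤ ℓ) (hℓ' : 0 ≤ ℓ') {χ : TSite d (towerP L m (n + 1)) → ℝ} {χ' : TSite d m → ℝ}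
  (hχ : ∀ b : Bond d (towerP L m (n + 1)), |χ (bpos b) - χ (btgt b)| ≤ ℓ * η)
  (hχ' : ∀ (y : TSite d m) (x : TSite d (towerP L m (n + 1))),
    blockCoord (L ^ (n + 1)) m (siteCast (towerP_eq_fineP_pow L m (n + 1)) x) = y → |χ' y - χ x| ≤ ℓ')

include hφ hφ' hMφ hMφ' hη hU ha' hRS hCQ hQ hγ hγ1 coercive hκ₁ hκ hℓ hℓ' hχ hχ' in
/-- **THE CONJUGATED PROJECTION `P_k(U) = 1 − R_k(U)` OF THE TOWER ON THE CIRCLE `‖κ‖ = ρ`**: radius windows `ρℓη ≤ 1`, `ρℓ′ ≤ 1`, `2ρℓM_φM_φ′√d ≤ β ≤ 1`,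
`2ρℓ′C_Q ≤ β`, `3(1+a′)β² ≤ γ∕4`, `12·s_A·β ≤ √κ₁` (`s_A = 4∕γ + C_Q(4∕γ)²(3 + a′(2C_Q+1))`) ⟹ `‖exp(κ•M_S) ∘ (1 − R_k(U)) ∘ exp(κ•(−M_S))‖ ≤ 2` —
`B9Eq349ConjugatedDPChainTower.norm_conjProjk_chain_le_two` with `S^{(±)} := exp(±κ•M_S)` and the bond ∕ block multipliers built inside the proof.
[cite: Balaban1985BackgroundPropagators, (3.49) p.399, Thm 3.2 (3.48) p.398, (3.21)∕(3.25) p.394] -/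
theorem norm_conjProjk_le_of_circle {β ρ : ℝ} (hβ : 0 ≤ β) (hβ1 : β ≤ 1)
    {MS : SiteL2K ℂ d (towerP L m (n + 1)) c₀ W →L[ℂ] SiteL2K ℂ d (towerP L m (n + 1)) c₀ W}
    (hMS : ∀ (f : SiteL2K ℂ d (towerP L m (n + 1)) c₀ W) (x : TSite d (towerP L m (n + 1))),
      WL2.equiv ℂ (fun _ : TSite d (towerP L m (n + 1)) => c₀) W (MS f) x =
        (χ x : ℂ) • WL2.equiv ℂ (fun _ : TSite d (towerP L m (n + 1)) => c₀) W f x)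
    (hwin : ρ * ℓ * η ≤ 1) (hwin' : ρ * ℓ' ≤ 1)
    (hβD : 2 * ρ * ℓ * (Mφ * Mφ') * Real.sqrt d ≤ β) (hβQ : 2 * ρ * ℓ' * CQ ≤ β) (small : 3 * (1 + a') * β ^ 2 ≤ γ / 4)
    (hwinκ : 12 * (β * (4 / γ + CQ * ((4 / γ) ^ 2 * (3 + a' * (2 * CQ + 1))))) ≤ Real.sqrt κ₁)
    (κ : ℂ) (hκr : ‖κ‖ = ρ) :
    ‖exp (κ • MS) ∘L LinearMap.toContinuousLinearMap (LinearMap.id - RofUk L m n φ η U (c₀ := c₀)) ∘L exp (κ • (-MS))‖ ≤ 2 := by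
  refine ContinuousLinearMap.opNorm_le_bound _ (by positivity) fun x => ?_
  have hS : ∀ (f : SiteL2K ℂ d (towerP L m (n + 1)) c₀ W) (x : TSite d (towerP L m (n + 1))),
      WL2.equiv ℂ (fun _ : TSite d (towerP L m (n + 1)) => c₀) W
          (((exp (κ • MS) : SiteL2K ℂ d (towerP L m (n + 1)) c₀ W →L[ℂ] SiteL2K ℂ d (towerP L m (n + 1)) c₀ W) :
            SiteL2K ℂ d (towerP L m (n + 1)) c₀ W →ₗ[ℂ] SiteL2K ℂ d (towerP L m (n + 1)) c₀ W) f) x =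
        Complex.exp (κ * (χ x : ℂ)) • WL2.equiv ℂ (fun _ : TSite d (towerP L m (n + 1)) => c₀) W f x :=
    fun f x => B9Eq3101ExpPointwiseMultiplier.equiv_exp_smul_apply_complex MS χ hMS κ f x
  have hSinv : ∀ (f : SiteL2K ℂ d (towerP L m (n + 1)) c₀ W) (x : TSite d (towerP L m (n + 1))),
      WL2.equiv ℂ (fun _ : TSite d (towerP L m (n + 1)) => c₀) W
          (((exp (κ • (-MS)) : SiteL2K ℂ d (towerP L m (n + 1)) c₀ W →L[ℂ] SiteL2K ℂ d (towerP L m (n + 1)) c₀ W) :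
            SiteL2K ℂ d (towerP L m (n + 1)) c₀ W →ₗ[ℂ] SiteL2K ℂ d (towerP L m (n + 1)) c₀ W) f) x =
        Complex.exp (-(κ * (χ x : ℂ))) • WL2.equiv ℂ (fun _ : TSite d (towerP L m (n + 1)) => c₀) W f x :=
    fun f x => B9Eq3101ExpPointwiseMultiplier.equiv_exp_smul_neg_apply_complex MS χ hMS κ f x
  let SB : BondL2K ℂ d (towerP L m (n + 1)) c₀ W →ₗ[ℂ] BondL2K ℂ d (towerP L m (n + 1)) c₀ W :=
    (WL2.linearEquiv ℂ ℂ (fun _ : Bond d (towerP L m (n + 1)) => c₀)).symm.toLinearMap ∘ₗ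
      (LinearMap.pi fun b => Complex.exp (κ * (χ (bpos b) : ℂ)) • LinearMap.proj b) ∘ₗ
        (WL2.linearEquiv ℂ ℂ (fun _ : Bond d (towerP L m (n + 1)) => c₀)).toLinearMap
  have hSB : ∀ (g : BondL2K ℂ d (towerP L m (n + 1)) c₀ W) (b : Bond d (towerP L m (n + 1))),
      WL2.equiv ℂ (fun _ : Bond d (towerP L m (n + 1)) => c₀) W (SB g) b =
        Complex.exp (κ * (χ (bpos b) : ℂ)) • WL2.equiv ℂ (fun _ : Bond d (towerP L m (n + 1)) => c₀) W g b := fun _ _ => rfl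
  let SBinv : BondL2K ℂ d (towerP L m (n + 1)) c₀ W →ₗ[ℂ] BondL2K ℂ d (towerP L m (n + 1)) c₀ W :=
    (WL2.linearEquiv ℂ ℂ (fun _ : Bond d (towerP L m (n + 1)) => c₀)).symm.toLinearMap ∘ₗ
      (LinearMap.pi fun b => Complex.exp (-(κ * (χ (bpos b) : ℂ))) • LinearMap.proj b) ∘ₗ
        (WL2.linearEquiv ℂ ℂ (fun _ : Bond d (towerP L m (n + 1)) => c₀)).toLinearMap
  have hSBinv : ∀ (g : BondL2K ℂ d (towerP L m (n + 1)) c₀ W) (b : Bond d (towerP L m (n + 1))),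
      WL2.equiv ℂ (fun _ : Bond d (towerP L m (n + 1)) => c₀) W (SBinv g) b =
        Complex.exp (-(κ * (χ (bpos b) : ℂ))) • WL2.equiv ℂ (fun _ : Bond d (towerP L m (n + 1)) => c₀) W g b := fun _ _ => rfl
  let SG : SiteL2K ℂ d m c₁ W →ₗ[ℂ] SiteL2K ℂ d m c₁ W :=
    (WL2.linearEquiv ℂ ℂ (fun _ : TSite d m => c₁)).symm.toLinearMap ∘ₗ
      (LinearMap.pi fun y => Complex.exp (κ * (χ' y : ℂ)) • LinearMap.proj y) ∘ₗ (WL2.linearEquiv ℂ ℂ (fun _ : TSite d m => c₁)).toLinearMap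
  have hSG : ∀ (g : SiteL2K ℂ d m c₁ W) (y : TSite d m),
      WL2.equiv ℂ (fun _ : TSite d m => c₁) W (SG g) y = Complex.exp (κ * (χ' y : ℂ)) • WL2.equiv ℂ (fun _ : TSite d m => c₁) W g y :=
    fun _ _ => rfl
  let SGinv : SiteL2K ℂ d m c₁ W →ₗ[ℂ] SiteL2K ℂ d m c₁ W :=
    (WL2.linearEquiv ℂ ℂ (fun _ : TSite d m => c₁)).symm.toLinearMap ∘ₗ
      (LinearMap.pi fun y => Complex.exp (-(κ * (χ' y : ℂ))) • LinearMap.proj y) ∘ₗ (WL2.linearEquiv ℂ ℂ (fun _ : TSite d m => c₁)).toLinearMap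
  have hSGinv : ∀ (g : SiteL2K ℂ d m c₁ W) (y : TSite d m),
      WL2.equiv ℂ (fun _ : TSite d m => c₁) W (SGinv g) y = Complex.exp (-(κ * (χ' y : ℂ))) • WL2.equiv ℂ (fun _ : TSite d m => c₁) W g y :=
    fun _ _ => rfl
  have hwinκ0 : ‖κ‖ * ℓ * η ≤ 1 := by rw [hκr]; exact hwin
  have hwinκ' : ‖κ‖ * ℓ' ≤ 1 := by rw [hκr]; exact hwin'
  have hβD' : 2 * ‖κ‖ * ℓ * (Mφ * Mφ') * Real.sqrt d ≤ β := by rw [hκr]; exact hβD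
  have hβQ' : 2 * ‖κ‖ * ℓ' * CQ ≤ β := by rw [hκr]; exact hβQ
  have h := norm_conjProjk_chain_le_two hφ hφ' hMφ hMφ' hη hU ha' hRS hpos' hCQ hQ hℓ hℓ' hχ hχ' hwinκ0 hwinκ' hS hSinv hSB hSBinv hSG hSGinv
    hγ hγ1 hκ₁ hCQ hβ hβ1 coercive hκ hQ hβD' hβQ' small hwinκ x
  simpa only [ContinuousLinearMap.comp_apply, LinearMap.coe_toContinuousLinearMap', LinearMap.sub_apply, LinearMap.id_apply,
    ContinuousLinearMap.coe_coe] using h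

end Circle

/-! ## §2 Big-block decay of `P_k(U) = 1 − R_k(U)` at every height with the letters `γ`, `C_Q`, `κ₁` displayed -/

section Instance

variable {d : ℕ} {L : ℕ} [NeZero L] {m : Fin d → ℕ} [∀ i, NeZero (m i)] {n : ℕ}
  {𝔸 : Type*} [NormedRing 𝔸] [NormedAlgebra ℂ 𝔸] [CompleteSpace 𝔸] [NormOneClass 𝔸]
  {W : Type*} [NormedAddCommGroup W] [InnerProductSpace ℂ W] [FiniteDimensional ℂ W] {φ : W ≃ₗ[ℂ] 𝔸} {Mφ Mφ' : ℝ}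
  (hφ : ∀ w, ‖φ w‖ ≤ Mφ * ‖w‖) (hφ' : ∀ X, ‖φ.symm X‖ ≤ Mφ' * ‖X‖) (hMφ : 0 ≤ Mφ) (hMφ' : 0 ≤ Mφ')
  {c₀ : ℝ} [Fact (0 < c₀)] {η : ℝ} {U : Bond d (towerP L m (n + 1)) → 𝔸ˣ} (hU : ∀ b, U b ∈ U1 𝔸)
  {c₁ : ℝ} [Fact (0 < c₁)] {a' : ℝ}
  (hRS : ∀ (b : Bond d (towerP L m (n + 1))) (v u : W), ⟪adTransportW φ U b v, u⟫_ℂ = ⟪v, adTransportW φ (fun b => (U b)⁻¹) b u⟫_ℂ)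
  (hpos' : ∀ x : SiteL2K ℂ d (towerP L m (n + 1)) c₀ W, x ≠ 0 → 0 < RCLike.re ⟪x, laplacePrimeAk L m n φ η U a' (c₁ := c₁) x⟫_ℂ)

include hφ hφ' hMφ hMφ' hU hRS in
/-- **BIG-BLOCK DECAY OF PRINT's `k`-LEVEL PROJECTION `P_k(U) = 1 − R_k(U)` FROM THREE LETTERS, AT EVERY HEIGHT** — on print's diagonal `ηL^{n+1} = 1`, the
site coercivity `γ ≤ 1`, the size `C_Q` and the third operator's form certificate `κ₁` (KAPPA1) DISPLAYED, windows `ρ ≤ 1`, `2ρM_φM_φ′√d ≤ β ≤ 1`,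
`2ρC_Q ≤ β`, `3(1+a′)β² ≤ γ∕4`, `12·s_A·β ≤ √κ₁`: for EVERY big-block family `P` and ANY positivity witness, `‖P_{y₁} ∘ (1 − R_k(U)) ∘ P_{y₀}‖ ≤
2·e^{ρ}·e^{−ρ·d_m(y₀,y₁)}` — (3.49)'s `P` line at `k` levels in `L²` block-operator currency (§1 on the circle, slack `ℓ = ℓ′ = 1`, fed to
`B9Eq349ConjugatedGreenBlockDecayTower.norm_block_le_exp_of_uniform_circle_bound_cast` at `N = L^{n+1}`). [cite: Balaban1985BackgroundPropagators, (3.49) p.399, Thm 3.11 p.416, (3.21) p.394] -/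
theorem block_decay_Pk_of_letters (hm : ∀ i, 1 ≤ m i) (hηL : η * (L : ℝ) ^ (n + 1) = 1) (ha' : 0 ≤ a')
    {CQ : ℝ} (hCQ : 0 ≤ CQ)
    (hQ : ∀ s, ‖((WL2.linearEquiv ℂ ℂ (fun _ : TSite d m => c₁)).symm.toLinearMap ∘ₗ QprimeTowerW L m n φ U (c₀ := c₀)) s‖ ≤ CQ * ‖s‖)
    {γ : ℝ} (hγ : 0 < γ) (hγ1 : γ ≤ 1)
    (coercive : ∀ f : SiteL2K ℂ d (towerP L m (n + 1)) c₀ W, γ * ‖f‖ ^ 2 ≤ ‖(covDerivL2K ℂ c₀ ((η : ℂ))⁻¹ (adTransportW φ U)) f‖ ^ 2 +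
      a' * ‖((WL2.linearEquiv ℂ ℂ (fun _ : TSite d m => c₁)).symm.toLinearMap ∘ₗ QprimeTowerW L m n φ U (c₀ := c₀)) f‖ ^ 2)
    {κ₁ : ℝ} (hκ₁ : 0 < κ₁)
    (hκ : ∀ ψ : SiteL2K ℂ d m c₁ W, κ₁ * ‖ψ‖ ^ 2 ≤ RCLike.re ⟪ψ,
      (((WL2.linearEquiv ℂ ℂ (fun _ : TSite d m => c₁)).symm.toLinearMap ∘ₗ QprimeTowerW L m n φ U (c₀ := c₀)) ∘ₗ
        GpOfUk L m n φ η U a' (c₁ := c₁) hpos' ∘ₗ GpOfUk L m n φ η U a' (c₁ := c₁) hpos' ∘ₗ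
        LinearMap.adjoint ((WL2.linearEquiv ℂ ℂ (fun _ : TSite d m => c₁)).symm.toLinearMap ∘ₗ QprimeTowerW L m n φ U (c₀ := c₀))) ψ⟫_ℂ)
    {β ρ : ℝ} (hβ : 0 ≤ β) (hβ1 : β ≤ 1) (hρ : 0 ≤ ρ) (hρ1 : ρ ≤ 1) (hβD : 2 * ρ * (Mφ * Mφ') * Real.sqrt d ≤ β) (hβQ : 2 * ρ * CQ ≤ β)
    (small : 3 * (1 + a') * β ^ 2 ≤ γ / 4)
    (hwinκ : 12 * (β * (4 / γ + CQ * ((4 / γ) ^ 2 * (3 + a' * (2 * CQ + 1))))) ≤ Real.sqrt κ₁)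
    (PS : TSite d m → SiteL2K ℂ d (towerP L m (n + 1)) c₀ W →L[ℂ] SiteL2K ℂ d (towerP L m (n + 1)) c₀ W)
    (hPS : ∀ (y : TSite d m) (f : SiteL2K ℂ d (towerP L m (n + 1)) c₀ W) (x : TSite d (towerP L m (n + 1))),
      WL2.equiv ℂ (fun _ : TSite d (towerP L m (n + 1)) => c₀) W (PS y f) x =
        if blockCoord (L ^ (n + 1)) m (siteCast (towerP_eq_fineP_pow L m (n + 1)) x) = y then
          WL2.equiv ℂ (fun _ : TSite d (towerP L m (n + 1)) => c₀) W f x else 0)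
    (y₀ y₁ : TSite d m) :
    ‖PS y₁ ∘L LinearMap.toContinuousLinearMap (LinearMap.id - RofUk L m n φ η U (c₀ := c₀)) ∘L PS y₀‖ ≤
      2 * Real.exp ρ * Real.exp (-(ρ * tdist m y₀ y₁)) := by
  have hL0 : (0 : ℝ) < L := by exact_mod_cast Nat.pos_of_ne_zero (NeZero.ne L)
  have hLp : (0 : ℝ) < (L : ℝ) ^ (n + 1) := pow_pos hL0 _
  have hηeq : η = 1 / (L : ℝ) ^ (n + 1) := by rw [eq_div_iff hLp.ne']; exact hηL
  have hη : 0 < η := by rw [hηeq]; positivity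
  have hη1 : η ≤ 1 := by
    rw [hηeq, div_le_one hLp]
    exact one_le_pow₀ (by exact_mod_cast Nat.one_le_iff_ne_zero.mpr (NeZero.ne L))
  have hι : 1 / ((L ^ (n + 1) : ℕ) : ℝ) ≤ 1 * η := by rw [Nat.cast_pow, one_mul, hηeq]
  have hwin : ρ * 1 * η ≤ 1 := by nlinarith
  exact norm_block_le_exp_of_uniform_circle_bound_cast (towerP_eq_fineP_pow L m (n + 1)) hm _ hPS hρ zero_le_two hι le_rfl
    (fun χ χ' hχ hχ' MS hMS κ hκr =>
      norm_conjProjk_le_of_circle hφ hφ' hMφ hMφ' hη hU ha' hRS hpos' hCQ hQ hγ hγ1 coercive hκ₁ hκ zero_le_one zero_le_one hχ hχ'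
        hβ hβ1 hMS hwin (by rwa [mul_one]) (by simpa only [mul_one] using hβD) (by simpa only [mul_one] using hβQ) small hwinκ κ hκr) y₀ y₁

end Instance

/-! ## §3 `∃ (α₁, C, ρ)` BEFORE the height, GIVEN the third operator's uniform form certificate `κ₁` (KAPPA1's letter) -/

section Exists

variable {d : ℕ} (L : ℕ) [NeZero L] {𝔸 : Type*} [NormedRing 𝔸] [NormedAlgebra ℂ 𝔸] [CompleteSpace 𝔸] [NormOneClass 𝔸]
  {W : Type*} [NormedAddCommGroup W] [InnerProductSpace ℂ W] [FiniteDimensional ℂ W] (φ : W ≃ₗ[ℂ] 𝔸) {a' Mφ Mφ' : ℝ}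
  (hMφ : 0 ≤ Mφ) (hMφ' : 0 ≤ Mφ') (hφ : ∀ w, ‖φ w‖ ≤ Mφ * ‖w‖) (hφ' : ∀ X, ‖φ.symm X‖ ≤ Mφ' * ‖X‖) (ha' : 0 < a')
  {r : ℝ} (hr0 : 0 ≤ r) (hr1 : r < 1)

include hMφ hMφ' hφ hφ' ha' hr0 hr1 in
/-- **`∃ α₁ C ρ > 0` BEFORE `∀ n`, GIVEN `κ₁ > 0`: THE BIG-BLOCK `L²` DECAY OF PRINT's `k`-LEVEL PROJECTION `P_k(U) = 1 − R_k(U)`, UNIFORM IN THE HEIGHT, THE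
VOLUME AND THE BACKGROUND OF THE WINDOW, MODULO THE ONE LETTER `κ₁`** — at EVERY height `n`, on print's diagonal `ηL^{n+1} = 1`, `c₀(L^{n+1})^d = c₁`, for
every period `m`, every background of the window (`hRS`, `U ∈ U1`, `‖U − 1‖ ≤ αη`, `α ≤ α₁`, `‖Ū^j − 1‖ ≤ ε_j ≤ αr^j` in `U1`), ANY positivity witness,
whenever `κ₁‖ψ‖² ≤ re⟪ψ, Q̃′_kG′_k²Q̃′_k†ψ⟫` (KAPPA1), every big-block family `P`: `‖P_{y₁} ∘ (1 − R_k(U)) ∘ P_{y₀}‖ ≤ C·e^{−ρ·d_m(y₀,y₁)}`.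
`γ′, α₀` := MY g64 `exists_strong_site_coercive_tower_diagonal` (`γ := min γ′ 1`); `C_Q ≤ E := e^{d(L−1)·2M_φM_φ′α₀∕(1−r)}`;
`β := min(1, γ∕(12(1+a′)), √κ₁∕(12 s_A))`, `s_A = 4∕γ + E(4∕γ)²(3 + a′(2E+1))`; `ρ := β∕(2(M_φM_φ′√d + E + 1))`; `C := 2e^{ρ}`.
[cite: Balaban1985BackgroundPropagators, (3.49) p.399, Thm 3.11 p.416, Thm 3.2 (3.48) p.398, (3.21) p.394] -/
theorem exists_block_decay_Pk {κ₁ : ℝ} (hκ₁ : 0 < κ₁) :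
    ∃ α₁ C ρ : ℝ, 0 < α₁ ∧ 0 ≤ C ∧ 0 < ρ ∧ ∀ (n : ℕ) (η : ℝ), η * (L : ℝ) ^ (n + 1) = 1 →
      ∀ (c₀ c₁ : ℝ) [Fact (0 < c₀)] [Fact (0 < c₁)], c₀ * ((L : ℝ) ^ (n + 1)) ^ d = c₁ →
      ∀ (m : Fin d → ℕ) [∀ i, NeZero (m i)], (∀ i, 1 ≤ m i) → ∀ (U : Bond d (towerP L m (n + 1)) → 𝔸ˣ),
        (∀ (b : Bond d (towerP L m (n + 1))) (v u : W), ⟪adTransportW φ U b v, u⟫_ℂ = ⟪v, adTransportW φ (fun b => (U b)⁻¹) b u⟫_ℂ) →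
      ∀ (α : ℝ), 0 ≤ α → α ≤ α₁ → (∀ b, U b ∈ U1 𝔸) → (∀ b, ‖(U b : 𝔸) - 1‖ ≤ α * η) →
      ∀ (εU : ℕ → ℝ), (∀ j, 0 ≤ εU j) → (∀ j < n + 1, εU j ≤ α * r ^ j) →
        (∀ (j : ℕ) (b : Bond d (towerP L m (j + 1))), ‖(UlevOf L m (n + 1) U j b : 𝔸) - 1‖ ≤ εU j) →
        (∀ (j : ℕ) (b : Bond d (towerP L m (j + 1))), UlevOf L m (n + 1) U j b ∈ U1 𝔸) →
      ∀ (hpos' : ∀ x : SiteL2K ℂ d (towerP L m (n + 1)) c₀ W, x ≠ 0 → 0 < RCLike.re ⟪x, laplacePrimeAk L m n φ η U a' (c₁ := c₁) x⟫_ℂ),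
        (∀ ψ : SiteL2K ℂ d m c₁ W, κ₁ * ‖ψ‖ ^ 2 ≤ RCLike.re ⟪ψ,
          (((WL2.linearEquiv ℂ ℂ (fun _ : TSite d m => c₁)).symm.toLinearMap ∘ₗ QprimeTowerW L m n φ U (c₀ := c₀)) ∘ₗ
            GpOfUk L m n φ η U a' (c₁ := c₁) hpos' ∘ₗ GpOfUk L m n φ η U a' (c₁ := c₁) hpos' ∘ₗ
            LinearMap.adjoint ((WL2.linearEquiv ℂ ℂ (fun _ : TSite d m => c₁)).symm.toLinearMap ∘ₗ QprimeTowerW L m n φ U (c₀ := c₀))) ψ⟫_ℂ) →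
      ∀ (PS : TSite d m → SiteL2K ℂ d (towerP L m (n + 1)) c₀ W →L[ℂ] SiteL2K ℂ d (towerP L m (n + 1)) c₀ W),
        (∀ (y : TSite d m) (f : SiteL2K ℂ d (towerP L m (n + 1)) c₀ W) (x : TSite d (towerP L m (n + 1))),
          WL2.equiv ℂ (fun _ : TSite d (towerP L m (n + 1)) => c₀) W (PS y f) x =
            if blockCoord (L ^ (n + 1)) m (siteCast (towerP_eq_fineP_pow L m (n + 1)) x) = y then
              WL2.equiv ℂ (fun _ : TSite d (towerP L m (n + 1)) => c₀) W f x else 0) →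
      ∀ (y₀ y₁ : TSite d m),
        ‖PS y₁ ∘L LinearMap.toContinuousLinearMap (LinearMap.id - RofUk L m n φ η U (c₀ := c₀)) ∘L PS y₀‖ ≤ C * Real.exp (-(ρ * tdist m y₀ y₁)) := by
  obtain ⟨α₀, γ', hα₀, hγ', hcoer⟩ :=
    B9Thm311SitePrimeFormCoerciveTowerCanonical.exists_strong_site_coercive_tower_diagonal L φ (a' := a') hMφ hMφ' hφ hφ' ha' hr0 hr1
  obtain ⟨γ, hγ0, hγ1, hγle, hγdef⟩ : ∃ γ : ℝ, 0 < γ ∧ γ ≤ 1 ∧ γ ≤ γ' ∧ γ = min γ' 1 := ⟨_, lt_min hγ' one_pos, min_le_right _ _, min_le_left _ _, rfl⟩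
  obtain ⟨E, hE0, hEdef⟩ : ∃ E : ℝ, 0 ≤ E ∧ E = Real.exp (((d * (L - 1) : ℕ) : ℝ) * (2 * Mφ * Mφ' * α₀ / (1 - r))) :=
    ⟨_, (Real.exp_pos _).le, rfl⟩
  obtain ⟨sA, hsA0, hsAdef⟩ : ∃ sA : ℝ, 0 < sA ∧ sA = 4 / γ + E * ((4 / γ) ^ 2 * (3 + a' * (2 * E + 1))) := ⟨_, by positivity, rfl⟩
  obtain ⟨β, hβ0, hβ1, hβγ, hβκ, hβdef⟩ : ∃ β : ℝ, 0 < β ∧ β ≤ 1 ∧ β ≤ γ / (12 * (1 + a')) ∧ β ≤ Real.sqrt κ₁ / (12 * sA) ∧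
      β = min 1 (min (γ / (12 * (1 + a'))) (Real.sqrt κ₁ / (12 * sA))) :=
    ⟨_, lt_min one_pos (lt_min (by positivity) (div_pos (Real.sqrt_pos.mpr hκ₁) (by positivity))), min_le_left _ _,
      (min_le_right _ _).trans (min_le_left _ _), (min_le_right _ _).trans (min_le_right _ _), rfl⟩
  obtain ⟨ρ, hρ0, hρdef⟩ : ∃ ρ : ℝ, 0 < ρ ∧ ρ = β / (2 * (Mφ * Mφ' * Real.sqrt d + E + 1)) := ⟨_, by positivity, rfl⟩
  have hK0 : 0 ≤ Mφ * Mφ' * Real.sqrt d := mul_nonneg (mul_nonneg hMφ hMφ') (Real.sqrt_nonneg (d : ℝ))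
  have hρβ : 2 * ρ * (Mφ * Mφ' * Real.sqrt d + E + 1) = β := by rw [hρdef]; field_simp
  have hρ1 : ρ ≤ 1 := by nlinarith
  have hβD : 2 * ρ * (Mφ * Mφ') * Real.sqrt d ≤ β := by nlinarith
  have hβE : 2 * ρ * E ≤ β := by nlinarith
  have small : 3 * (1 + a') * β ^ 2 ≤ γ / 4 := by
    have h1 : β ^ 2 ≤ β * 1 := by nlinarith
    have h2 : 3 * (1 + a') * (γ / (12 * (1 + a'))) = γ / 4 := by field_simp; ring
    nlinarith [mul_le_mul_of_nonneg_left hβγ (by positivity : (0 : ℝ) ≤ 3 * (1 + a'))]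
  have hwinκ : 12 * (β * sA) ≤ Real.sqrt κ₁ :=
    calc 12 * (β * sA) ≤ 12 * (Real.sqrt κ₁ / (12 * sA) * sA) := by gcongr
      _ = Real.sqrt κ₁ := by field_simp
  refine ⟨α₀, 2 * Real.exp ρ, ρ, hα₀, by positivity, hρ0, ?_⟩
  intro n η hηL c₀ c₁ _ _ hw m _ hm U hRS α hα hαle hUb hUε εU hεU hεg hLε hLb hpos' hκ PS hPS y₀ y₁
  have hQ := fun s => norm_QtildeTower_le_of_profile (φ := φ) (U := U) (c₁ := c₁) hφ hφ' hMφ hMφ' hw hα hr0 hr1 εU hεU hεg hLε hLb s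
  have hEα : Real.exp (((d * (L - 1) : ℕ) : ℝ) * (2 * Mφ * Mφ' * α / (1 - r))) ≤ E := by
    rw [hEdef]
    refine Real.exp_le_exp.mpr (mul_le_mul_of_nonneg_left ?_ (Nat.cast_nonneg _))
    have h1r : 0 < 1 - r := by linarith
    exact div_le_div_of_nonneg_right (by nlinarith [mul_nonneg hMφ hMφ']) h1r.le
  have hQE : ∀ s : SiteL2K ℂ d (towerP L m (n + 1)) c₀ W,
      ‖((WL2.linearEquiv ℂ ℂ (fun _ : TSite d m => c₁)).symm.toLinearMap ∘ₗ QprimeTowerW L m n φ U (c₀ := c₀)) s‖ ≤ E * ‖s‖ :=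
    fun s => (hQ s).trans (mul_le_mul_of_nonneg_right hEα (norm_nonneg _))
  have coercive : ∀ f : SiteL2K ℂ d (towerP L m (n + 1)) c₀ W,
      γ * ‖f‖ ^ 2 ≤ ‖(covDerivL2K ℂ c₀ ((η : ℂ))⁻¹ (adTransportW φ U)) f‖ ^ 2 +
        a' * ‖((WL2.linearEquiv ℂ ℂ (fun _ : TSite d m => c₁)).symm.toLinearMap ∘ₗ QprimeTowerW L m n φ U (c₀ := c₀)) f‖ ^ 2 := by
    intro f
    have key := hcoer n η hηL c₀ c₁ hw m U hRS α hα hαle hUb hUε εU hεU hεg hLε hLb f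
    rw [re_inner_laplacePrimeAk L m n φ η U a' hRS] at key
    have h1 : γ * ‖f‖ ^ 2 ≤ γ' * ‖f‖ ^ 2 := mul_le_mul_of_nonneg_right hγle (sq_nonneg _)
    have h2 : γ' * ‖f‖ ^ 2 ≤ γ' * (‖covDerivL2K ℂ c₀ ((η : ℂ))⁻¹ (adTransportW φ (fun _ : Bond d (towerP L m (n + 1)) => (1 : 𝔸ˣ))) f‖ ^ 2 +
        ‖f‖ ^ 2) := mul_le_mul_of_nonneg_left (le_add_of_nonneg_left (sq_nonneg _)) hγ'.le
    exact h1.trans (h2.trans key)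
  have hwinκ' : 12 * (β * (4 / γ + E * ((4 / γ) ^ 2 * (3 + a' * (2 * E + 1))))) ≤ Real.sqrt κ₁ := by rw [← hsAdef]; exact hwinκ
  exact block_decay_Pk_of_letters hφ hφ' hMφ hMφ' hUb hRS hpos' hm hηL ha'.le hE0 hQE hγ0 hγ1 coercive hκ₁ hκ hβ0.le hβ1 hρ0.le hρ1 hβD hβE small
    hwinκ' PS hPS y₀ y₁

end Exists

end Literature.MathematicalPhysics.QuantumFieldTheory.Balaban1983to89.B9Eq349ConjugatedProjectionBlockDecayTower

end
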